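/-
Copyright (c) 2026 the pub-hodgecm-mathlib formalisation cell (harness21).  Prover seat hodgecm-mathlib-F0P3a-p02 (g27), 2026-09-03.  Road M6 «ROW 2 ★ DYADIC TWIN» → F3
«TOT-Λ BY OVER-ORDERS» (LEAD F0P3a-plan T14-66 ∕ T15-08; WORD #77 queue), carve (c10b-S) «GATE AT b = 0, SUFFICIENCY» (F3-5 pen LH7-p04 (g12) 00:24:06Z ∕ 00:34:25Z),
part (S3-D) «THE DETERMINANT LINK» (SIG-c10b-S v1 ad4dff8922f419ee, F0P3a-p02 (g27)).
-/
import Literature.NumberTheory.Automorphic.SelfDualProductOrderGateWitness   -- (S3-W) (this seat): `transpose_map_mul_mul_apply_eq_dotProduct`, orthogonality, `pairing_zero_snd_zero_snd_eq`; brings ★ p853089 (c10b-N) `pairing_adjoint`, ★ F3-2b FILE 1 (T1), ★ `HeckeTransversalGL` (`valuation_det_eq_one_of_mem_glInt`)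
import HarnessLib

/-!
# The gate at glue depth `b = 0`, sufficiency, part D: the determinant link `⟨x₀′, x₀′⟩ · N(ν⋆) ∈ −N(E^×)·det J`

Topic `NumberTheory/Automorphic`; namespace `Literature.NumberTheory.Automorphic`.  THEOREMS ONLY (no definition, no instance, no notation, no named fact, no `sorry`);
kernel lane `--supports stmt-HodgeConjecture-24833`.  Cell `pub/hodgecm-mathlib` (D-0151), crux H413 = `stmt-HodgeConjecture-24833`; road M6 → F3 «TOT-Λ by over-orders»,
carve (c10b-S) «gate at `b = 0`, sufficiency» (SIG-c10b-S v1): (S1) «K-LINE GRAM» + (S2) «NORM SUPPLY» (LH10-p01 (g11)), (S3-W) the witness (`SelfDualProductOrderGateWitness`), and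
**(S3-D) = THIS FILE**: the link between the `E`-line class `⟨x₀′, x₀′⟩` (`x₀′ = φ(1,0)w₀`) and the `K`-plane datum that decides whether (S2) can supply `b₂` — in ★ F3-2a ∕ F3-2b's
endoscopic currency VERBATIM plus the Eisenstein relation of the `K`-generator at the FIELD level (`θ : K`, `θ² = a·θ + k`, `a k : E` through `algebraMap`, `σ_K θ = θ`, `1, θ`
`E`-independent).  With `ℓ(y) := P(e₂, (0, y))`, `l₀ := ℓ(1)`, `l₁ := ℓ(θ)` and `N(ν⋆) := l₁² − a·l₀·l₁ − k·l₀²` (the `K∕E`-norm of `ν⋆ = l₁ − l₀θ`, written without the Galois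
conjugation): **`⟨x₀′,x₀′⟩ · (l₀(a l₁ + k l₀) − l₁²) = σ(det M)·det J·det M`** for the basis `M = [x₀′ | φ(e₂)w₀ | φ(0,θ)w₀] ∈ GL₃(E)`, hence
`|⟨x₀′,x₀′⟩ · N(ν⋆)| = |det M · σ(det M)|` — a NORM's valuation (so `log|⟨x₀′,x₀′⟩| + log|N(ν⋆)|` is even once `σ` is valuation-preserving), and `⟨x₀′,x₀′⟩ ≠ 0`, `N(ν⋆) ≠ 0`.
The parity reading (class I ⟺ `|l₁|² > |ϖ|·|l₀|²` ⟺ `ν` is a `σ_K`-norm) is the (S3-A) assembly's, on top of (S1)(S2).  No `2`, no `d`, no parity binder, no discreteness; `n = 3`.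
HONEST LABEL: HC_CM is proved only modulo the 7 printed citations (2 remaining named inputs: hLiu418 = stmt-HodgeConjecture-24832, h413 = stmt-HodgeConjecture-24833) until
rung 0 closes; elementary linear algebra over a valuation ring, asserts nothing printed; count-neutral (zero label movement until F5 ★ and a desk-priced rider).

THE MATHEMATICS.  By the adjoint (★ `pairing_adjoint`) the Gram matrix of `M` is block diagonal `diag(d₀, G_K)` (orthogonality `E × 0 ⊥ 0 × K`), with
`G_K = [[ℓ(1), ℓ(θ)], [ℓ(σ_Kθ·1), ℓ(σ_Kθ·θ)]] = [[l₀, l₁], [l₁, a l₁ + k l₀]]` (`σ_Kθ = θ`, `θ² = aθ + k`, `ℓ` `E`-linear); `det = d₀(l₀(al₁ + kl₀) − l₁²) = −d₀·N(ν⋆)`; and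
`det(σ(M)ᵀJM) = σ(det M)·det J·det M` with `|det J| = 1`.  `det M ≠ 0` because `b ↦ φ(b)w₀` is injective (★ (T1)) and `e₁, e₂, (0,θ)` are `E`-independent in `E × K`.
[cite: Jacobowitz1962, §4, §7 Thm. 7.1] [cite: Rogawski1990, §4.9 Lemma 4.9.3 p. 56] [cite: HornJohnson2013, §0.8.5, §3.2.4]

* §1 `pairing_zero_snd_add_right`, `pairing_zero_snd_smul_right` (`E`-linearity of `y ↦ P(m, (0, y))`), `pairing_theta_theta_eq` (`P((0,θ),(0,θ)) = a·l₁ + k·l₀`),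
  `pairing_theta_one_eq` (`P((0,θ),(0,1)) = l₁`).
* §2 `det_basis_ne_zero`, **`det_gram_basis_eq`**, **`valuation_pairing_mul_norm_eq`** (the link, with `⟨x₀′,x₀′⟩ ≠ 0` and `N(ν⋆) ≠ 0` as conjuncts).

## References
* [Jacobowitz1962] R. Jacobowitz, *Hermitian forms over local fields*, Amer. J. Math. 84 (1962): §4 (Gram matrices, discriminants), §7 Thm. 7.1.
* [Rogawski1990] J. D. Rogawski, *Automorphic Representations of Unitary Groups in Three Variables*, Ann. of Math. Stud. 123 (1990): §4.9 Lemma 4.9.3 p. 56, Prop. 4.9.1 (b) p. 55.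
* [HornJohnson2013] R. A. Horn, C. R. Johnson, *Matrix Analysis* (2nd ed. 2013): §0.8.5 (block determinants), §3.2.4 (cyclic vectors).
* [Serre1980Trees] J.-P. Serre, *Trees* (1980): Ch. II §1.1 (lattices over valuation rings).
-/

set_option autoImplicit false

noncomputable section

open Matrix
open scoped MatrixGroups ValuativeRel

namespace Literature.NumberTheory.Automorphic

open Literature.NumberTheory.Automorphic.UnitaryGroup

section DetLink

variable {E : Type*} [Field E] [ValuativeRel E] (σ : E →+* E) {K : Type*} [Field K] [ValuativeRel K] [Algebra E K] (σK : K →+* K)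
  (J : GL (Fin 3) E) (hJ : J ∈ glInt 3 E)
  (τ : Matrix (Fin 3) (Fin 3) E) {w₀ : Fin 3 → E} (hK : IsUnit (Matrix.of fun i j : Fin 3 => ((τ ^ (j : ℕ)) *ᵥ w₀) i).det)
  (φ : (E × K) →ₐ[E] Matrix (Fin 3) (Fin 3) E) (hφ : Function.Injective φ) (τB : E × K) (hτB : φ τB = τ)
  (hstar : ∀ b : E × K, (J : Matrix (Fin 3) (Fin 3) E) * φ (RingHom.prodMap σ σK b) = ((φ b).map σ)ᵀ * J)
  {θ : K} {a k : E} (hθ : θ ^ 2 = algebraMap E K a * θ + algebraMap E K k) (hσKθ : σK θ = θ)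
  (hθE : ∀ p q : E, algebraMap E K p + algebraMap E K q * θ = 0 → p = 0 ∧ q = 0)

/-! ## §1 `E`-linearity of `y ↦ P(m, (0, y))` and the `K`-plane Gram entries at `(1, θ)` -/

omit [ValuativeRel E] [ValuativeRel K] in
/-- `P(m, (0, y + y′)) = P(m, (0, y)) + P(m, (0, y′))`. [cite: Jacobowitz1962, §4] -/
theorem pairing_zero_snd_add_right (m : E × K) (y y' : K) :
    dotProduct (fun i => σ ((φ m *ᵥ w₀) i)) ((J : Matrix (Fin 3) (Fin 3) E) *ᵥ (φ ((0, y + y') : E × K) *ᵥ w₀)) =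
      dotProduct (fun i => σ ((φ m *ᵥ w₀) i)) ((J : Matrix (Fin 3) (Fin 3) E) *ᵥ (φ ((0, y) : E × K) *ᵥ w₀)) +
        dotProduct (fun i => σ ((φ m *ᵥ w₀) i)) ((J : Matrix (Fin 3) (Fin 3) E) *ᵥ (φ ((0, y') : E × K) *ᵥ w₀)) := by
  have h : ((0, y + y') : E × K) = ((0, y) : E × K) + ((0, y') : E × K) := by ext <;> simp
  rw [h, map_add, Matrix.add_mulVec, Matrix.mulVec_add, dotProduct_add]

omit [ValuativeRel E] [ValuativeRel K] in
/-- `P(m, (0, c • y)) = c · P(m, (0, y))` (`φ` is `E`-linear). [cite: Jacobowitz1962, §4] -/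
theorem pairing_zero_snd_smul_right (m : E × K) (c : E) (y : K) :
    dotProduct (fun i => σ ((φ m *ᵥ w₀) i)) ((J : Matrix (Fin 3) (Fin 3) E) *ᵥ (φ ((0, algebraMap E K c * y) : E × K) *ᵥ w₀)) =
      c * dotProduct (fun i => σ ((φ m *ᵥ w₀) i)) ((J : Matrix (Fin 3) (Fin 3) E) *ᵥ (φ ((0, y) : E × K) *ᵥ w₀)) := by
  have h : ((0, algebraMap E K c * y) : E × K) = c • ((0, y) : E × K) := by
    ext <;> simp [Algebra.smul_def]
  rw [h, ← smul_mulVec_idem_eq φ, Matrix.mulVec_smul, dotProduct_smul, smul_eq_mul]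

omit [ValuativeRel E] [ValuativeRel K] in
include hstar hθ hσKθ in
/-- `P((0, θ), (0, θ)) = a·l₁ + k·l₀` (`= ℓ(σ_Kθ·θ) = ℓ(θ²) = ℓ(aθ + k)`, `l₀ = P(e₂,(0,1))`, `l₁ = P(e₂,(0,θ))`). [cite: Jacobowitz1962, §4] -/
theorem pairing_theta_theta_eq :
    dotProduct (fun i => σ ((φ ((0, θ) : E × K) *ᵥ w₀) i)) ((J : Matrix (Fin 3) (Fin 3) E) *ᵥ (φ ((0, θ) : E × K) *ᵥ w₀)) =
      a * dotProduct (fun i => σ ((φ ((0, 1) : E × K) *ᵥ w₀) i)) ((J : Matrix (Fin 3) (Fin 3) E) *ᵥ (φ ((0, θ) : E × K) *ᵥ w₀)) +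
        k * dotProduct (fun i => σ ((φ ((0, 1) : E × K) *ᵥ w₀) i)) ((J : Matrix (Fin 3) (Fin 3) E) *ᵥ (φ ((0, (1 : K)) : E × K) *ᵥ w₀)) := by
  rw [pairing_zero_snd_zero_snd_eq σ σK J φ hstar θ θ, hσKθ, ← sq, hθ, pairing_zero_snd_add_right σ J φ, pairing_zero_snd_smul_right σ J φ,
    ← mul_one (algebraMap E K k), pairing_zero_snd_smul_right σ J φ]

omit [ValuativeRel E] [ValuativeRel K] in
include hstar hσKθ in
/-- `P((0, θ), (0, 1)) = l₁ = P((0, 1), (0, θ))` (`σ_K θ = θ`). [cite: Jacobowitz1962, §4] -/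
theorem pairing_theta_one_eq :
    dotProduct (fun i => σ ((φ ((0, θ) : E × K) *ᵥ w₀) i)) ((J : Matrix (Fin 3) (Fin 3) E) *ᵥ (φ ((0, (1 : K)) : E × K) *ᵥ w₀)) =
      dotProduct (fun i => σ ((φ ((0, 1) : E × K) *ᵥ w₀) i)) ((J : Matrix (Fin 3) (Fin 3) E) *ᵥ (φ ((0, θ) : E × K) *ᵥ w₀)) := by
  rw [pairing_zero_snd_zero_snd_eq σ σK J φ hstar θ 1, hσKθ, mul_one]

/-! ## §2 The basis `M = [x₀′ | φ(e₂)w₀ | φ(0,θ)w₀]`, its Gram determinant, and the link -/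

omit [ValuativeRel E] [ValuativeRel K] in
include hK hφ hτB hθE in
/-- `det [x₀′ | φ(e₂)w₀ | φ(0,θ)w₀] ≠ 0`: `b ↦ φ(b)w₀` is injective (★ (T1)) and `e₁, e₂, (0, θ)` are `E`-independent. [cite: HornJohnson2013, §3.2.4] -/
theorem det_basis_ne_zero :
    (Matrix.of fun i j => (![φ ((1, 0) : E × K) *ᵥ w₀, φ ((0, 1) : E × K) *ᵥ w₀, φ ((0, θ) : E × K) *ᵥ w₀] : Fin 3 → Fin 3 → E) j i).det ≠ 0 := by
  set M : Matrix (Fin 3) (Fin 3) E := Matrix.of fun i j => (![φ ((1, 0) : E × K) *ᵥ w₀, φ ((0, 1) : E × K) *ᵥ w₀, φ ((0, θ) : E × K) *ᵥ w₀] : Fin 3 → Fin 3 → E) j i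
    with hM
  suffices h : Function.Injective M.mulVec by
    have hu := Matrix.mulVec_injective_iff_isUnit.1 h
    exact ((Matrix.isUnit_iff_isUnit_det M).1 hu).ne_zero
  intro c c' hcc'
  -- `M c = φ(c₀ e₁ + c₁ e₂ + c₂ (0,θ)) w₀`
  have hMv : ∀ c : Fin 3 → E, M *ᵥ c = φ (((c 0, algebraMap E K (c 1) + algebraMap E K (c 2) * θ) : E × K)) *ᵥ w₀ := by
    intro c
    have hsplit : ((c 0, algebraMap E K (c 1) + algebraMap E K (c 2) * θ) : E × K) =
        c 0 • ((1, 0) : E × K) + c 1 • ((0, 1) : E × K) + c 2 • ((0, θ) : E × K) := by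
      ext <;> simp [Algebra.smul_def]
    rw [hsplit, map_add, map_add, map_smul, map_smul, map_smul, Matrix.add_mulVec, Matrix.add_mulVec, Matrix.smul_mulVec, Matrix.smul_mulVec,
      Matrix.smul_mulVec]
    funext i
    simp [hM, Matrix.mulVec, dotProduct, Fin.sum_univ_three]
    ring
  rw [hMv, hMv] at hcc'
  have h0 : φ ((((c 0, algebraMap E K (c 1) + algebraMap E K (c 2) * θ) : E × K) -
      ((c' 0, algebraMap E K (c' 1) + algebraMap E K (c' 2) * θ) : E × K))) *ᵥ w₀ = 0 := by
    rw [map_sub, Matrix.sub_mulVec, hcc', sub_self]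
  have hb := eq_zero_of_map_mulVec_eq_zero τ hK φ hφ τB hτB h0
  rw [sub_eq_zero, Prod.mk.injEq] at hb
  have h2 : algebraMap E K (c 1 - c' 1) + algebraMap E K (c 2 - c' 2) * θ = 0 := by
    rw [map_sub, map_sub]; linear_combination hb.2
  obtain ⟨h1', h2'⟩ := hθE _ _ h2
  funext i
  fin_cases i
  · exact hb.1
  · exact sub_eq_zero.1 h1'
  · exact sub_eq_zero.1 h2'

omit [ValuativeRel E] [ValuativeRel K] in
include hstar hθ hσKθ in
/-- **THE GRAM DETERMINANT OF THE BASIS `M = [x₀′ | φ(e₂)w₀ | φ(0,θ)w₀]`**: `det(σ(M)ᵀJM) = ⟨x₀′,x₀′⟩ · (l₀·(a l₁ + k l₀) − l₁·l₁)` (block diagonal by orthogonality, §1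
entries). [cite: Jacobowitz1962, §4] [cite: HornJohnson2013, §0.8.5] -/
theorem det_gram_basis_eq :
    (((Matrix.of fun i j => (![φ ((1, 0) : E × K) *ᵥ w₀, φ ((0, 1) : E × K) *ᵥ w₀, φ ((0, θ) : E × K) *ᵥ w₀] : Fin 3 → Fin 3 → E) j i).map σ)ᵀ *
        (J : Matrix (Fin 3) (Fin 3) E) *
        (Matrix.of fun i j => (![φ ((1, 0) : E × K) *ᵥ w₀, φ ((0, 1) : E × K) *ᵥ w₀, φ ((0, θ) : E × K) *ᵥ w₀] : Fin 3 → Fin 3 → E) j i)).det =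
      dotProduct (fun i => σ ((φ ((1, 0) : E × K) *ᵥ w₀) i)) ((J : Matrix (Fin 3) (Fin 3) E) *ᵥ (φ ((1, 0) : E × K) *ᵥ w₀)) *
        (dotProduct (fun i => σ ((φ ((0, 1) : E × K) *ᵥ w₀) i)) ((J : Matrix (Fin 3) (Fin 3) E) *ᵥ (φ ((0, (1 : K)) : E × K) *ᵥ w₀)) *
            (a * dotProduct (fun i => σ ((φ ((0, 1) : E × K) *ᵥ w₀) i)) ((J : Matrix (Fin 3) (Fin 3) E) *ᵥ (φ ((0, θ) : E × K) *ᵥ w₀)) +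
              k * dotProduct (fun i => σ ((φ ((0, 1) : E × K) *ᵥ w₀) i)) ((J : Matrix (Fin 3) (Fin 3) E) *ᵥ (φ ((0, (1 : K)) : E × K) *ᵥ w₀))) -
          dotProduct (fun i => σ ((φ ((0, 1) : E × K) *ᵥ w₀) i)) ((J : Matrix (Fin 3) (Fin 3) E) *ᵥ (φ ((0, θ) : E × K) *ᵥ w₀)) *
            dotProduct (fun i => σ ((φ ((0, 1) : E × K) *ᵥ w₀) i)) ((J : Matrix (Fin 3) (Fin 3) E) *ᵥ (φ ((0, θ) : E × K) *ᵥ w₀))) := by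
  set col : Fin 3 → (Fin 3 → E) := ![φ ((1, 0) : E × K) *ᵥ w₀, φ ((0, 1) : E × K) *ᵥ w₀, φ ((0, θ) : E × K) *ᵥ w₀] with hcol
  set M : Matrix (Fin 3) (Fin 3) E := Matrix.of fun i j => col j i with hM
  set G : Matrix (Fin 3) (Fin 3) E := (M.map σ)ᵀ * (J : Matrix (Fin 3) (Fin 3) E) * M with hG
  have hGapply : ∀ i j : Fin 3, G i j = dotProduct (fun t => σ (col i t)) ((J : Matrix (Fin 3) (Fin 3) E) *ᵥ col j) := by
    intro i j
    rw [hG, transpose_map_mul_mul_apply_eq_dotProduct σ J M i j]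
    rfl
  have hG01 : G 0 1 = 0 := by rw [hGapply]; exact pairing_fst_zero_snd_eq_zero σ σK J φ hstar 1 1
  have hG02 : G 0 2 = 0 := by rw [hGapply]; exact pairing_fst_zero_snd_eq_zero σ σK J φ hstar 1 θ
  have hG10 : G 1 0 = 0 := by rw [hGapply]; exact pairing_zero_snd_fst_eq_zero σ σK J φ hstar 1 1
  have hG20 : G 2 0 = 0 := by rw [hGapply]; exact pairing_zero_snd_fst_eq_zero σ σK J φ hstar 1 θ
  have hG22 : G 2 2 = a * dotProduct (fun i => σ ((φ ((0, 1) : E × K) *ᵥ w₀) i)) ((J : Matrix (Fin 3) (Fin 3) E) *ᵥ (φ ((0, θ) : E × K) *ᵥ w₀)) +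
      k * dotProduct (fun i => σ ((φ ((0, 1) : E × K) *ᵥ w₀) i)) ((J : Matrix (Fin 3) (Fin 3) E) *ᵥ (φ ((0, (1 : K)) : E × K) *ᵥ w₀)) := by
    rw [hGapply]; exact pairing_theta_theta_eq σ σK J φ hstar hθ hσKθ
  have hG21 : G 2 1 = dotProduct (fun i => σ ((φ ((0, 1) : E × K) *ᵥ w₀) i)) ((J : Matrix (Fin 3) (Fin 3) E) *ᵥ (φ ((0, θ) : E × K) *ᵥ w₀)) := by
    rw [hGapply]; exact pairing_theta_one_eq σ σK J φ hstar hσKθ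
  have hG00 : G 0 0 = dotProduct (fun i => σ ((φ ((1, 0) : E × K) *ᵥ w₀) i)) ((J : Matrix (Fin 3) (Fin 3) E) *ᵥ (φ ((1, 0) : E × K) *ᵥ w₀)) := by
    rw [hGapply]; rfl
  have hG11 : G 1 1 = dotProduct (fun i => σ ((φ ((0, 1) : E × K) *ᵥ w₀) i)) ((J : Matrix (Fin 3) (Fin 3) E) *ᵥ (φ ((0, (1 : K)) : E × K) *ᵥ w₀)) := by
    rw [hGapply]; rfl
  have hG12 : G 1 2 = dotProduct (fun i => σ ((φ ((0, 1) : E × K) *ᵥ w₀) i)) ((J : Matrix (Fin 3) (Fin 3) E) *ᵥ (φ ((0, θ) : E × K) *ᵥ w₀)) := by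
    rw [hGapply]; rfl
  change G.det = _
  rw [Matrix.det_fin_three, hG00, hG01, hG02, hG10, hG11, hG12, hG20, hG21, hG22]
  ring

omit [ValuativeRel K] in
include hJ hK hφ hτB hstar hθ hσKθ hθE in
/-- **THE DETERMINANT LINK.**  With `d₀ := ⟨x₀′,x₀′⟩`, `l₀ := P(e₂,(0,1))`, `l₁ := P(e₂,(0,θ))`, `N(ν⋆) := l₁² − a l₀ l₁ − k l₀²` and `M = [x₀′ | φ(e₂)w₀ | φ(0,θ)w₀]`:
**`|d₀ · N(ν⋆)| = |det M · σ(det M)|`** (`det(σ(M)ᵀJM) = σ(det M)·det J·det M`, `|det J| = 1`, and `det(σ(M)ᵀJM) = −d₀·N(ν⋆)` by `det_gram_basis_eq`) — so `d₀·N(ν⋆)` has the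
valuation of a NORM, and both factors are non-zero (`det M ≠ 0`). [cite: Jacobowitz1962, §4, §7 Thm. 7.1] [cite: Rogawski1990, §4.9 Lemma 4.9.3 p. 56] -/
theorem valuation_pairing_mul_norm_eq :
    ValuativeRel.valuation E
        (dotProduct (fun i => σ ((φ ((1, 0) : E × K) *ᵥ w₀) i)) ((J : Matrix (Fin 3) (Fin 3) E) *ᵥ (φ ((1, 0) : E × K) *ᵥ w₀)) *
          (dotProduct (fun i => σ ((φ ((0, 1) : E × K) *ᵥ w₀) i)) ((J : Matrix (Fin 3) (Fin 3) E) *ᵥ (φ ((0, θ) : E × K) *ᵥ w₀)) *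
              dotProduct (fun i => σ ((φ ((0, 1) : E × K) *ᵥ w₀) i)) ((J : Matrix (Fin 3) (Fin 3) E) *ᵥ (φ ((0, θ) : E × K) *ᵥ w₀)) -
            a * dotProduct (fun i => σ ((φ ((0, 1) : E × K) *ᵥ w₀) i)) ((J : Matrix (Fin 3) (Fin 3) E) *ᵥ (φ ((0, (1 : K)) : E × K) *ᵥ w₀)) *
              dotProduct (fun i => σ ((φ ((0, 1) : E × K) *ᵥ w₀) i)) ((J : Matrix (Fin 3) (Fin 3) E) *ᵥ (φ ((0, θ) : E × K) *ᵥ w₀)) -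
            k * dotProduct (fun i => σ ((φ ((0, 1) : E × K) *ᵥ w₀) i)) ((J : Matrix (Fin 3) (Fin 3) E) *ᵥ (φ ((0, (1 : K)) : E × K) *ᵥ w₀)) *
              dotProduct (fun i => σ ((φ ((0, 1) : E × K) *ᵥ w₀) i)) ((J : Matrix (Fin 3) (Fin 3) E) *ᵥ (φ ((0, (1 : K)) : E × K) *ᵥ w₀)))) =
      ValuativeRel.valuation E
        ((Matrix.of fun i j => (![φ ((1, 0) : E × K) *ᵥ w₀, φ ((0, 1) : E × K) *ᵥ w₀, φ ((0, θ) : E × K) *ᵥ w₀] : Fin 3 → Fin 3 → E) j i).det *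
          σ (Matrix.of fun i j => (![φ ((1, 0) : E × K) *ᵥ w₀, φ ((0, 1) : E × K) *ᵥ w₀, φ ((0, θ) : E × K) *ᵥ w₀] : Fin 3 → Fin 3 → E) j i).det) ∧
    dotProduct (fun i => σ ((φ ((1, 0) : E × K) *ᵥ w₀) i)) ((J : Matrix (Fin 3) (Fin 3) E) *ᵥ (φ ((1, 0) : E × K) *ᵥ w₀)) ≠ 0 ∧
    dotProduct (fun i => σ ((φ ((0, 1) : E × K) *ᵥ w₀) i)) ((J : Matrix (Fin 3) (Fin 3) E) *ᵥ (φ ((0, θ) : E × K) *ᵥ w₀)) *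
          dotProduct (fun i => σ ((φ ((0, 1) : E × K) *ᵥ w₀) i)) ((J : Matrix (Fin 3) (Fin 3) E) *ᵥ (φ ((0, θ) : E × K) *ᵥ w₀)) -
        a * dotProduct (fun i => σ ((φ ((0, 1) : E × K) *ᵥ w₀) i)) ((J : Matrix (Fin 3) (Fin 3) E) *ᵥ (φ ((0, (1 : K)) : E × K) *ᵥ w₀)) *
          dotProduct (fun i => σ ((φ ((0, 1) : E × K) *ᵥ w₀) i)) ((J : Matrix (Fin 3) (Fin 3) E) *ᵥ (φ ((0, θ) : E × K) *ᵥ w₀)) -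
        k * dotProduct (fun i => σ ((φ ((0, 1) : E × K) *ᵥ w₀) i)) ((J : Matrix (Fin 3) (Fin 3) E) *ᵥ (φ ((0, (1 : K)) : E × K) *ᵥ w₀)) *
          dotProduct (fun i => σ ((φ ((0, 1) : E × K) *ᵥ w₀) i)) ((J : Matrix (Fin 3) (Fin 3) E) *ᵥ (φ ((0, (1 : K)) : E × K) *ᵥ w₀)) ≠ 0 := by
  set M : Matrix (Fin 3) (Fin 3) E :=
    Matrix.of fun i j => (![φ ((1, 0) : E × K) *ᵥ w₀, φ ((0, 1) : E × K) *ᵥ w₀, φ ((0, θ) : E × K) *ᵥ w₀] : Fin 3 → Fin 3 → E) j i with hM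
  set d₀ : E := dotProduct (fun i => σ ((φ ((1, 0) : E × K) *ᵥ w₀) i)) ((J : Matrix (Fin 3) (Fin 3) E) *ᵥ (φ ((1, 0) : E × K) *ᵥ w₀)) with hd₀
  set l₀ : E := dotProduct (fun i => σ ((φ ((0, 1) : E × K) *ᵥ w₀) i)) ((J : Matrix (Fin 3) (Fin 3) E) *ᵥ (φ ((0, (1 : K)) : E × K) *ᵥ w₀)) with hl₀
  set l₁ : E := dotProduct (fun i => σ ((φ ((0, 1) : E × K) *ᵥ w₀) i)) ((J : Matrix (Fin 3) (Fin 3) E) *ᵥ (φ ((0, θ) : E × K) *ᵥ w₀)) with hl₁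
  have hdet : ((M.map σ)ᵀ * (J : Matrix (Fin 3) (Fin 3) E) * M).det = d₀ * (l₀ * (a * l₁ + k * l₀) - l₁ * l₁) :=
    det_gram_basis_eq σ σK J φ hstar hθ hσKθ
  have hdet' : ((M.map σ)ᵀ * (J : Matrix (Fin 3) (Fin 3) E) * M).det = σ M.det * (J : Matrix (Fin 3) (Fin 3) E).det * M.det := by
    rw [Matrix.det_mul, Matrix.det_mul, Matrix.det_transpose, ← RingHom.mapMatrix_apply, ← RingHom.map_det]
  have hM0 : M.det ≠ 0 := det_basis_ne_zero τ hK φ hφ τB hτB hθE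
  have hJ1 : ValuativeRel.valuation E (J : Matrix (Fin 3) (Fin 3) E).det = 1 := valuation_det_eq_one_of_mem_glInt hJ
  have hJ0 : (J : Matrix (Fin 3) (Fin 3) E).det ≠ 0 := fun h0 => by rw [h0, map_zero] at hJ1; exact zero_ne_one hJ1
  have hprod : d₀ * (l₀ * (a * l₁ + k * l₀) - l₁ * l₁) = σ M.det * (J : Matrix (Fin 3) (Fin 3) E).det * M.det := by rw [← hdet, hdet']
  have hne : d₀ * (l₀ * (a * l₁ + k * l₀) - l₁ * l₁) ≠ 0 := by
    rw [hprod]; exact mul_ne_zero (mul_ne_zero ((map_ne_zero σ).2 hM0) hJ0) hM0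
  have hkey : d₀ * (l₁ * l₁ - a * l₀ * l₁ - k * l₀ * l₀) = -(σ M.det * (J : Matrix (Fin 3) (Fin 3) E).det * M.det) := by
    rw [← hprod]; ring
  refine ⟨?_, (mul_ne_zero_iff.1 hne).1, fun h0 => hne ?_⟩
  · rw [hkey, Valuation.map_neg, map_mul, map_mul, hJ1, mul_one, map_mul, mul_comm]
  · have : l₀ * (a * l₁ + k * l₀) - l₁ * l₁ = -(l₁ * l₁ - a * l₀ * l₁ - k * l₀ * l₀) := by ring
    rw [this, h0, neg_zero, mul_zero]

end DetLink

end Literature.NumberTheory.Automorphic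

end
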